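import Mathlib.RepresentationTheory.Basic
import Mathlib.RepresentationTheory.Subrepresentation
import Literature.NumberTheory.Automorphic.RealMatrixGroups
import Literature.NumberTheory.Automorphic.GKModules
import Literature.NumberTheory.Automorphic.ArchimedeanCalculus
import Literature.NumberTheory.Automorphic.AdelicGroupData
import Literature.NumberTheory.Automorphic.SmoothRepresentation
import HarnessLib

-- provenance: harness21/H21/H21/Prelude/AutomorphicL/AutomorphicForms.lean @ 33cdf37 (interim HEAD d8f2665); M5 mechanical rewrite
/-!
# Automorphic forms and automorphic representations for a general automorphy datum

Trunk: AutomorphicL (prelude, item I12 `AutomorphicForms`; notions `automorphic_form`,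
`automorphic_representation`; design D2, reviews 2 and 12).

Let `K` be a number field and `𝒢 : AdelicGroupData K` the accepted axiomatic adelic datum of G19
(`𝒢.Adelic = G(𝔸_K)`, `𝒢.arithmeticSubgroup = G(K) ≤ G(𝔸_K)`). An *automorphy datum*
`𝒟 : AutomorphyDatum 𝒢 A N` records what Borel–Jacquet, *Automorphic forms and automorphic
representations* (Corvallis 1979), §4.1 use to define automorphic forms on `G(𝔸_K)`:

* the archimedean group `G_∞` as a linear real group `𝒟.arch : RealMatrixGroup A N` (D2) with a
  continuous homomorphism `𝒟.ofArch : G_∞ →* G(𝔸_K)`;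
* the group of finite adeles `𝒟.finiteAdelic = G(𝔸_f) ≤ G(𝔸_K)`, commuting with `G_∞`;
* a non-empty family `𝒟.finiteLevels` of level subgroups `U ≤ G(𝔸_f)` (compact open subgroups in
  every instance);
* a height `𝒟.height : G(𝔸_K) → ℝ` (`‖g‖` of BJ §4.2) — a *bare datum*: no axiom on it is
  recorded in the structure (D2, review 12), since no definition consumes one. The properties
  that the (sorried) theorems of BJ §4.3–4.6 consume are bundled separately in the hypothesis
  structure `AutomorphyDatum.IsRegular`; for the honest `GL_n` datum they are theorems of
  `AdelicGLnGlue`.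

With this we define (BJ 4.2) `IsAutomorphicForm 𝒟 φ` for `φ : G(𝔸_K) → ℂ`: left
`G(K)`-invariance, right invariance under a level, smoothness / `K_∞`-finiteness /
`Z(𝔤)`-finiteness in the archimedean variable (accepted `ArchimedeanCalculus`), and moderate
growth `‖φ g‖ ≤ C (1 ⊔ ‖g‖)^r`; the space `automorphicForms 𝒟`; right translation
`rightTranslation 𝒢`; `(𝔤, K_∞) × G(𝔸_f)`-stable subspaces `IsStableSubmodule`; and an
*automorphic representation* as a datum `AutomorphicRepData 𝒟` = an irreducible stable
subquotient `W / W'` of the space of automorphic forms (BJ 4.6), with its `G(𝔸_f)`-action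
`π.finiteRep`, `K_∞`-action `π.kRep`, the predicate `π.HasLieAction ρ𝔤` pinning the `𝔤`-action,
`π.HasInfinitesimalCharacter θ` and `π.IsCuspidalIn C`.

## The mirror dictionary with G19 (D2, review 2)

G19's `𝒢.automorphicQuotient = G(𝔸_K) ⧸ (A_G · G(K))` is a *left*-coset space: functions on it
are *right*-`A_G G(K)`-invariant functions on `G(𝔸_K)` and `G(𝔸_K)` acts by
`rightRegular g f = f (g⁻¹ • ·)`. Borel–Jacquet forms are *left*-`G(K)`-invariant with `G(𝔸_K)`
acting by right translation (and are not `A_G`-invariant). The inversion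
`invQuot 𝒢 f g := f [g⁻¹]` translates: `invQuot 𝒢 f` is left-`A_G G(K)`-invariant
(`invQuot_mul_left`) and `invQuot` intertwines `f ↦ f (h⁻¹ • ·)` with `rightTranslation 𝒢 h`
(`invQuot_smul`). Every G25 ↔ G19 bridge goes through `invQuot`.

## Main statements (sorried unless marked real; known in print for reductive `G`)

All of them are stated for a *regular* datum (`𝒟.IsRegular`, see below) over a
finite-dimensional coefficient algebra `A`; without regularity (`𝔤` the full Lie algebra of
`G_∞`) smoothness in the archimedean variable is vacuous and BJ §1.3–1.6 do not apply.

* `mem_automorphicForms_iff` (BJ 4.3: automorphic forms form a vector space; needs only that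
  the levels are directed, `IsRegular.directedOn_finiteLevels`),
  `automorphicForms_isStableSubmodule` (BJ 4.3: stability under `G(𝔸_f)`, `K_∞`, `𝔤`; stated, as
  in the source's setting `A = K ⊗_ℚ ℝ`, for an `ℝ`-linear involution `[StarModule ℝ A]` — see the
  docstring — and proved in `AutomorphicFormsStableHolds`,
  `isStableSubmodule_automorphicForms_of_isRegular`),
  `AutomorphicRepData.exists_hasLieAction`, `AutomorphicRepData.hasLieAction_unique` (real),
  `AutomorphicRepData.isGKModule_of_hasLieAction` (BJ 4.6: `π` is a `(𝔤, K_∞)`-module);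
* BJ 4.5 / 4.6 (admissibility) is the *joint* admissibility of `(𝔤, K_∞) × G(𝔸_f)` on
  `W / W' ≅ π_∞ ⊗ π_f`, the DEFINITION (predicate on `π`, with explicit binder; its universal
  closure is refuted by `AutomorphicRepData.not_forall_isAdmissible` in
  `AutomorphicRepAdmissibility`) `AutomorphicRepData.IsAdmissible π`: `π.finiteRep` is smooth
  (`isSmooth_finiteRep`, needs only `IsRegular`) and for every compact open `U ≤ G(𝔸_f)` the
  `K_∞`-module `(W / W')^U` (`π.kRepFixed U`, real, via the real commutation
  `kRep_comm_finiteRep`) has finite `K_∞`-multiplicities (`isAdmissibleGK_kRepFixed`).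
  The latter genuinely needs Harish-Chandra's finiteness theorem BJ 4.3(i) (reduction theory
  for the reductive `G/K`), which no field of the general datum captures and which is *false*
  for a general datum (e.g. `G_∞ = 1`, `G(𝔸_f)` a discrete group with an infinite-dimensional
  simple module of bounded functions). It is therefore recorded as a second hypothesis
  structure `AutomorphyDatum.HasFiniteness` (`dim Hom_{K_∞}(τ, 𝒜(U, J)) < ∞`, with
  `levelForms 𝒟 U J = 𝒜(U, J)` and `kHomInto`), assumed in `isAdmissibleGK_kRepFixed` and
  `isAdmissible_finiteRep` and to be discharged for `GL_n` in `AdelicGLnGlue`; both facts also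
  assume an `ℝ`-linear involution on `A` (`[StarModule ℝ A]`, compactness of `K_∞`) and are
  proved in `AutomorphicRepAdmissibilityProofs`. NOTE for the
  architect: the outline's `isAdmissible_finiteRep (h𝒟 : IsRegular)` alone is unsatisfiable.
  (The naive "`π.finiteRep` is `Representation.IsAdmissible`" is also false:
  `(W / W')^U = π_∞ ⊗ π_f^U` is infinite-dimensional whenever `π_∞` is.)

## Design notes

* (H1) `attribute [local instance 100] LieRing.ofAssociativeRing`; (H4) `open scoped ContDiff`;
  no normed matrix instance is needed in this file (H3).
* Mathlib has `Representation`, `Representation.subrepresentation`, `Representation.quotient`,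
  `Submodule.comap`, `Submodule.span`, `Submodule.mkQ`, `QuotientGroup`; it has no automorphic
  forms (its `NumberTheory/ModularForms` is the classical `SL₂(ℤ)` theory on `ℍ`, a different
  object) and no automorphic representations. `rightTranslation` is definitionally Mathlib's
  `TannakaDuality.FiniteGroup.rightRegular` (`RepresentationTheory/Tannaka.lean`), which is
  however universe-monomorphic (`k G : Type u`) and lives in the finite-group Tannaka namespace,
  so it is redefined here (outline I12); it also agrees with the accepted `archTranslate`
  precomposed with `ofArch` (`archTranslate_ofArch`, `rfl`). `Representation.IsSmooth`,
  `Representation.fixedPoints` are the accepted H21 notions of `SmoothRepresentation`;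
  `IsGKModule`, `IsAdmissibleGK`, `HasInfinitesimalCharacter`, `centerU` are from the accepted
  `GKModules`; `IsArchSmooth`, `lieDeriv`, `IsKFinite`, `IsZFinite` from `ArchimedeanCalculus`.
* `IsRightInvariantUnder` is stated for any group; on `G(𝔸_K)` it is membership in
  `(rightTranslation 𝒢).fixedPoints U` (`isRightInvariantUnder_iff_mem_fixedPoints`).
  `HasModerateGrowth` uses `1 ⊔ ‖g‖`, so no lower bound on the height is needed and exponents
  can be increased freely.
* `IsStableSubmodule` and `IsAutomorphicForm` are `structure … : Prop` with named fields.
  `AutomorphicRepData.Quot` (outline name) shadows core `Quot` inside that namespace only;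
  `AutomorphicRepData.mkQ` is the linear map `Submodule.mkQ`.
* The coefficient types `A N` are `Type*` (outline: `Type`); `mixedSpace K : Type` fits.
* `AutomorphyDatum.IsRegular` (hypothesis structure, not part of the datum): `𝔤` is the full Lie
  algebra of `G_∞` and `G_∞ = K_∞ exp 𝔭` with `K_∞` compact (so `G_∞`, closed under conjugate
  transpose, is a real reductive group in Harish-Chandra's class — Knapp VII.§2, Example 5);
  levels are open in `G(𝔸_f)` and every open subgroup of `G(𝔸_f)` contains a level; and the
  height satisfies `1 ⊔ ‖g h‖ ≤ C_h (1 ⊔ ‖g‖)` for `h ∈ G(𝔸_f)` and locally uniformly for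
  `h ∈ G_∞` (BJ §4.2, properties of `‖·‖`). These are exactly what BJ's proofs of 4.3–4.5 use.

## References

* A. Borel, H. Jacquet, *Automorphic forms and automorphic representations*, Proc. Sympos.
  Pure Math. 33 (Corvallis 1979), part 1, 189–202, §4.
* Harish-Chandra, *Automorphic forms on semisimple Lie groups*, LNM 62 (1968), Thm. 1.
-/

-- Mathlib idiom (Mathlib/Algebra/Lie/OfAssociative.lean); needed to mention Lie subalgebras of matrix algebras
attribute [local instance 100] LieRing.ofAssociativeRing

open scoped MatrixGroups Matrix ContDiff

noncomputable section

namespace Literature.NumberTheory.Automorphic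

variable {K : Type} [Field K] [NumberField K]

/-! ## Invariance predicates, right translation and the mirror dictionary -/

section General

variable (𝒢 : AdelicGroupData K)

/-- `φ : G(𝔸_K) → ℂ` is *left `G(K)`-invariant*: `φ (γ g) = φ g` for `γ ∈ G(K)`
(`𝒢.arithmeticSubgroup`, **not** `A_G · G(K)`). Borel–Jacquet 1979, §4.2(a). [cite: BorelJacquet1979, §4.2(a] -/
def IsLeftInvariant (φ : 𝒢.Adelic → ℂ) : Prop :=
  ∀ γ ∈ 𝒢.arithmeticSubgroup, ∀ g, φ (γ * g) = φ g

/-- `φ : G → ℂ` is *right invariant under* the subgroup `U ≤ G`: `φ (g u) = φ g` for `u ∈ U`.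
Borel–Jacquet 1979, §4.2(a) (right invariance under a compact open `U ≤ G(𝔸_f)`). [cite: BorelJacquet1979, §4.2(a] -/
def IsRightInvariantUnder {G : Type*} [Group G] (U : Subgroup G) (φ : G → ℂ) : Prop :=
  ∀ u ∈ U, ∀ g, φ (g * u) = φ g

/-- Right translation `(r(h) φ)(g) = φ (g h)`, a complex representation of `G(𝔸_K)` on all
functions `G(𝔸_K) → ℂ`. Definitionally Mathlib's `TannakaDuality.FiniteGroup.rightRegular`,
which is universe-monomorphic and hence unusable here; redefined (outline I12).
Borel–Jacquet 1979, §4.3 and §4.6. [cite: BorelJacquet1979, §4.3 and §4.6] -/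
def rightTranslation : Representation ℂ 𝒢.Adelic (𝒢.Adelic → ℂ) where
  toFun h :=
    { toFun := fun φ g ↦ φ (g * h)
      map_add' := fun _ _ ↦ rfl
      map_smul' := fun _ _ ↦ rfl }
  map_one' := by ext; simp
  map_mul' h h' := by ext; simp [mul_assoc]

/-- `rightTranslation 𝒢 h φ g = φ (g * h)`. Borel–Jacquet 1979, §4.3. [cite: BorelJacquet1979, §4.3] -/
@[simp]
theorem rightTranslation_apply (h : 𝒢.Adelic) (φ : 𝒢.Adelic → ℂ) (g : 𝒢.Adelic) :
    rightTranslation 𝒢 h φ g = φ (g * h) := rfl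

/-- Right invariance under `U ≤ G(𝔸_K)` is membership in the `U`-fixed vectors of
`rightTranslation 𝒢` (accepted `Representation.fixedPoints`). Borel–Jacquet 1979, §4.2(a). [cite: BorelJacquet1979, §4.2(a] -/
theorem isRightInvariantUnder_iff_mem_fixedPoints (U : Subgroup 𝒢.Adelic) (φ : 𝒢.Adelic → ℂ) :
    IsRightInvariantUnder U φ ↔ φ ∈ (rightTranslation 𝒢).fixedPoints U := by
  simp only [IsRightInvariantUnder, Representation.mem_fixedPoints, funext_iff,
    rightTranslation_apply]

/-- The *inversion dictionary* with G19 (D2): a function `f` on the left-coset space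
`G(𝔸_K) ⧸ (A_G · G(K))` gives the function `g ↦ f [g⁻¹]` on `G(𝔸_K)`, which is
left-`A_G G(K)`-invariant. Borel–Jacquet 1979, §4.2 (left `G(K)`-invariance) versus the
Mathlib/G19 convention `G ⧸ H`. [cite: BorelJacquet1979, §4.2 (left  G(K] -/
def invQuot (f : 𝒢.automorphicQuotient → ℂ) : 𝒢.Adelic → ℂ :=
  fun g ↦ f (𝒢.toAutomorphicQuotient g⁻¹)

/-- `invQuot 𝒢 f g = f [g⁻¹]`. (D2 dictionary.) [folklore] -/
@[simp]
theorem invQuot_apply (f : 𝒢.automorphicQuotient → ℂ) (g : 𝒢.Adelic) :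
    invQuot 𝒢 f g = f (𝒢.toAutomorphicQuotient g⁻¹) := rfl

/-- `invQuot 𝒢 f` is left-invariant under `A_G · G(K)`: `invQuot 𝒢 f (γ g) = invQuot 𝒢 f g` for
`γ ∈ 𝒢.quotientSubgroup`. (D2 dictionary; Borel–Jacquet 1979, §4.2(a).) [cite: BorelJacquet1979, §4.2(a] -/
theorem invQuot_mul_left (f : 𝒢.automorphicQuotient → ℂ) {γ : 𝒢.Adelic}
    (hγ : γ ∈ 𝒢.quotientSubgroup) (g : 𝒢.Adelic) :
    invQuot 𝒢 f (γ * g) = invQuot 𝒢 f g := by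
  simp only [invQuot_apply, mul_inv_rev]
  congr 1
  exact QuotientGroup.mk_mul_of_mem _ (inv_mem hγ)

/-- `invQuot 𝒢 f` is left `G(K)`-invariant. (D2 dictionary; Borel–Jacquet 1979, §4.2(a).) [cite: BorelJacquet1979, §4.2(a] -/
theorem isLeftInvariant_invQuot (f : 𝒢.automorphicQuotient → ℂ) :
    IsLeftInvariant 𝒢 (invQuot 𝒢 f) :=
  fun _ hγ g ↦ invQuot_mul_left 𝒢 f (𝒢.arithmeticSubgroup_le_quotientSubgroup hγ) g

/-- `invQuot` intertwines G19's `rightRegular h f = f (h⁻¹ • ·)` with right translation: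
`invQuot 𝒢 (f (h⁻¹ • ·)) = r(h) (invQuot 𝒢 f)`. (D2 dictionary.) [folklore] -/
theorem invQuot_smul (f : 𝒢.automorphicQuotient → ℂ) (h : 𝒢.Adelic) :
    invQuot 𝒢 (fun y ↦ f (h⁻¹ • y)) = rightTranslation 𝒢 h (invQuot 𝒢 f) := by
  funext g
  simp only [invQuot_apply, rightTranslation_apply, mul_inv_rev]
  rfl

end General

/-! ## Automorphy data -/

/-- An *automorphy datum* for `𝒢 = (G(K) → G(𝔸_K))`: the archimedean group `G_∞` as a linear
real group `arch ≤ GL N A` with a continuous homomorphism `ofArch : G_∞ →* G(𝔸_K)`, the subgroup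
of finite adeles `finiteAdelic = G(𝔸_f)` commuting with `G_∞`, a non-empty family
`finiteLevels` of level subgroups of `G(𝔸_f)`, and a height function `height = ‖·‖` on `G(𝔸_K)`.
No axiom on the height is part of the datum (D2, review 12; see `AutomorphyDatum.IsRegular`).
Borel–Jacquet 1979, §4.1–4.2. [cite: BorelJacquet1979, §4.1–4.2] -/
structure AutomorphyDatum (𝒢 : AdelicGroupData K) (A : Type*) [NormedCommRing A]
    [NormedAlgebra ℝ A] [NormedAlgebra ℚ A] [CompleteSpace A] [StarRing A] (N : Type*) [Fintype N]
    [DecidableEq N] where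
  /-- The archimedean group `G_∞` as a linear real group. -/
  arch : RealMatrixGroup A N
  /-- The inclusion `G_∞ →* G(𝔸_K)`. -/
  ofArch : arch.carrier →* 𝒢.Adelic
  /-- `G_∞ → G(𝔸_K)` is continuous. -/
  continuous_ofArch : Continuous ofArch
  /-- The subgroup `G(𝔸_f) ≤ G(𝔸_K)` of finite-adelic points. -/
  finiteAdelic : Subgroup 𝒢.Adelic
  /-- `G_∞` and `G(𝔸_f)` commute inside `G(𝔸_K)`. -/
  commute_ofArch : ∀ g, ∀ h ∈ finiteAdelic, ofArch g * h = h * ofArch g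
  /-- The admissible levels `U ≤ G(𝔸_f)` (compact open subgroups in instances). -/
  finiteLevels : Set (Subgroup 𝒢.Adelic)
  /-- There is at least one level. -/
  finiteLevels_nonempty : finiteLevels.Nonempty
  /-- Levels are subgroups of `G(𝔸_f)`. -/
  le_finiteAdelic : ∀ U ∈ finiteLevels, U ≤ finiteAdelic
  /-- The height `‖g‖` used to define moderate growth (a bare datum). -/
  height : 𝒢.Adelic → ℝ

variable {A : Type*} [NormedCommRing A] [NormedAlgebra ℝ A] [NormedAlgebra ℚ A] [CompleteSpace A]
  [StarRing A] {N : Type*} [Fintype N] [DecidableEq N]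

namespace AutomorphyDatum

variable {𝒢 : AdelicGroupData K} (𝒟 : AutomorphyDatum 𝒢 A N)

/-- The inclusion `K_∞ →* G(𝔸_K)` of the maximal compact subgroup `K_∞ = G_∞ ∩ U(N, A)`.
Borel–Jacquet 1979, §4.1. [cite: BorelJacquet1979, §4.1] -/
def ofK : 𝒟.arch.maximalCompact →* 𝒢.Adelic :=
  𝒟.ofArch.comp (Subgroup.inclusion 𝒟.arch.maximalCompact_le_carrier)

/-- `𝒟.ofK k = 𝒟.ofArch k`. Borel–Jacquet 1979, §4.1. [cite: BorelJacquet1979, §4.1] -/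
@[simp]
theorem ofK_apply (k : 𝒟.arch.maximalCompact) :
    𝒟.ofK k = 𝒟.ofArch (Subgroup.inclusion 𝒟.arch.maximalCompact_le_carrier k) := rfl

/-- The accepted archimedean right translation `archTranslate 𝒟.ofArch` (through which
`IsKFinite`, `kTranslateSpan` are defined) is `rightTranslation 𝒢` precomposed with `ofArch`.
Borel–Jacquet 1979, §1.3 and §4.2. [cite: BorelJacquet1979, §1.3 and §4.2] -/
theorem archTranslate_ofArch (h : 𝒟.arch.carrier) :
    archTranslate 𝒟.ofArch h = rightTranslation 𝒢 (𝒟.ofArch h) := rfl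

/-- `archTranslate 𝒟.ofArch k = rightTranslation 𝒢 (𝒟.ofK k)` for `k ∈ K_∞`.
Borel–Jacquet 1979, §1.3 and §4.2. [cite: BorelJacquet1979, §1.3 and §4.2] -/
theorem archTranslate_ofK (k : 𝒟.arch.maximalCompact) :
    archTranslate 𝒟.ofArch (Subgroup.inclusion 𝒟.arch.maximalCompact_le_carrier k) =
      rightTranslation 𝒢 (𝒟.ofK k) := rfl

/-- The *regularity hypotheses* on an automorphy datum consumed by Borel–Jacquet's proofs of
§4.3–4.6 (a hypothesis structure, deliberately not part of `AutomorphyDatum`; D2, review 12):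
`𝔤 = arch.lie` is the full Lie algebra of `G_∞`; `G_∞ = K_∞ · exp 𝔭` with `K_∞` compact (so the
`star`-stable closed linear group `G_∞` is reductive in Harish-Chandra's class, Knapp VII.§2,
Example 5); the levels are open in `G(𝔸_f)` and cofinal among open subgroups; and the height
satisfies `1 ⊔ ‖g h‖ ≤ C_h (1 ⊔ ‖g‖)` for `h ∈ G(𝔸_f)`, locally uniformly for `h ∈ G_∞`
(Borel–Jacquet 1979, §4.2, properties of `‖·‖`; §1.2 (ii)–(iv)). [cite: BorelJacquet1979, §4.2  properties of  ‖·‖] -/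
structure IsRegular : Prop where
  /-- `𝔤` is the full Lie algebra of `G_∞`: every one-parameter subgroup of `G_∞` is generated
  by an element of `𝔤`. -/
  mem_lie_of_expGL_mem : ∀ X : Matrix N N A,
    (∀ t : ℝ, expGL (t • X) ∈ 𝒟.arch.carrier) → X ∈ 𝒟.arch.lie
  /-- `K_∞ = G_∞ ∩ U(N, A)` is compact (`A ≅ ℝ^r × ℂ^s`). -/
  isStarFormallyReal : IsStarFormallyReal A
  /-- Global Cartan decomposition `G_∞ = K_∞ exp 𝔭`. -/
  hasCartanDecomposition : 𝒟.arch.HasCartanDecomposition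
  /-- Levels are open in `G(𝔸_f)`. -/
  isOpen_level : ∀ U ∈ 𝒟.finiteLevels,
    IsOpen ((U.comap 𝒟.finiteAdelic.subtype : Subgroup 𝒟.finiteAdelic) : Set 𝒟.finiteAdelic)
  /-- Every open subgroup of `G(𝔸_f)` contains a level. -/
  exists_level_le : ∀ V : Subgroup 𝒢.Adelic,
    IsOpen ((V.comap 𝒟.finiteAdelic.subtype : Subgroup 𝒟.finiteAdelic) : Set 𝒟.finiteAdelic) →
      ∃ U ∈ 𝒟.finiteLevels, U ≤ V
  /-- `1 ⊔ ‖g h‖ ≤ C_h (1 ⊔ ‖g‖)` for `h ∈ G(𝔸_f)`. -/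
  height_mul_le : ∀ h ∈ 𝒟.finiteAdelic, ∃ C : ℝ, ∀ g,
    1 ⊔ 𝒟.height (g * h) ≤ C * (1 ⊔ 𝒟.height g)
  /-- `1 ⊔ ‖g x‖ ≤ C_s (1 ⊔ ‖g‖)` uniformly for `x` in a compact subset `s ⊆ G_∞`. -/
  height_mul_ofArch_le : ∀ s : Set 𝒟.arch.carrier, IsCompact s → ∃ C : ℝ, ∀ x ∈ s, ∀ g,
    1 ⊔ 𝒟.height (g * 𝒟.ofArch x) ≤ C * (1 ⊔ 𝒟.height g)

/-- For a regular datum the levels are directed downwards: any two levels contain a common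
level (their intersection is open in `G(𝔸_f)`, hence contains a level).
Borel–Jacquet 1979, §4.1 (compact open subgroups form a neighbourhood basis). [cite: BorelJacquet1979, §4.1 (compact open subgroups form a neig] -/
theorem IsRegular.directedOn_finiteLevels {𝒟 : AutomorphyDatum 𝒢 A N} (h𝒟 : 𝒟.IsRegular) :
    DirectedOn (· ≥ ·) 𝒟.finiteLevels := by
  intro U hU V hV
  obtain ⟨W, hW, hWle⟩ := h𝒟.exists_level_le (U ⊓ V) (by
    rw [Subgroup.comap_inf, Subgroup.coe_inf]
    exact (h𝒟.isOpen_level U hU).inter (h𝒟.isOpen_level V hV))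
  exact ⟨W, hW, (le_inf_iff.mp hWle).1, (le_inf_iff.mp hWle).2⟩

/-- The level `U ∈ 𝒟.finiteLevels` of a regular datum as an open subgroup of `G(𝔸_f)`.
Borel–Jacquet 1979, §4.1. [cite: BorelJacquet1979, §4.1] -/
def IsRegular.levelOpenSubgroup {𝒟 : AutomorphyDatum 𝒢 A N} (h𝒟 : 𝒟.IsRegular)
    (U : Subgroup 𝒢.Adelic) (hU : U ∈ 𝒟.finiteLevels) : OpenSubgroup 𝒟.finiteAdelic :=
  ⟨U.comap 𝒟.finiteAdelic.subtype, h𝒟.isOpen_level U hU⟩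

end AutomorphyDatum

/-! ## Automorphic forms (BJ 4.2) -/

section Forms

variable {𝒢 : AdelicGroupData K} (𝒟 : AutomorphyDatum 𝒢 A N)

/-- `φ` has *moderate growth* (is slowly increasing) with respect to the height of `𝒟`:
`‖φ g‖ ≤ C (1 ⊔ ‖g‖)^r` for some `C` and `r : ℕ`. Using `1 ⊔ ‖g‖` makes the condition
monotone in `r` with no lower bound on `‖·‖` needed. Borel–Jacquet 1979, §4.2(d) and §1.2. [cite: BorelJacquet1979, §4.2(d] -/
def HasModerateGrowth (φ : 𝒢.Adelic → ℂ) : Prop :=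
  ∃ (C : ℝ) (r : ℕ), ∀ g, ‖φ g‖ ≤ C * (1 ⊔ 𝒟.height g) ^ r

/-- **Automorphic forms** on `G(𝔸_K)` with respect to the automorphy datum `𝒟`
(Borel–Jacquet 1979, 4.2): `φ : G(𝔸_K) → ℂ` is (a) left `G(K)`-invariant and right invariant
under some level `U ∈ 𝒟.finiteLevels`, (b) smooth in the archimedean variable and right
`K_∞`-finite, (c) `Z(𝔤)`-finite, (d) of moderate growth. [cite: BorelJacquet1979, 4.2] -/
structure IsAutomorphicForm (φ : 𝒢.Adelic → ℂ) : Prop where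
  /-- (a) `φ (γ g) = φ g` for `γ ∈ G(K)`. -/
  leftInvariant : IsLeftInvariant 𝒢 φ
  /-- (a) `φ (g u) = φ g` for `u` in some level `U`. -/
  exists_level : ∃ U ∈ 𝒟.finiteLevels, IsRightInvariantUnder U φ
  /-- (b) `X ↦ φ (g exp X)` is smooth on `𝔤`. -/
  archSmooth : IsArchSmooth 𝒟.ofArch φ
  /-- (b) `φ` is right `K_∞`-finite. -/
  kFinite : IsKFinite 𝒟.ofArch φ
  /-- (c) `φ` is `Z(𝔤)`-finite. -/
  zFinite : IsZFinite 𝒟.ofArch φ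
  /-- (d) `φ` has moderate growth. -/
  moderateGrowth : HasModerateGrowth 𝒟 φ

/-- The space `𝒜(G(K)\G(𝔸_K))` of automorphic forms, as the complex span of the automorphic
forms (equal to the set of automorphic forms for regular data: `mem_automorphicForms_iff`).
Borel–Jacquet 1979, 4.2–4.3. [cite: BorelJacquet1979, 4.2–4.3] -/
def automorphicForms : Submodule ℂ (𝒢.Adelic → ℂ) :=
  Submodule.span ℂ {φ | IsAutomorphicForm 𝒟 φ}

/-- An automorphic form lies in the space of automorphic forms. Borel–Jacquet 1979, 4.2. [cite: BorelJacquet1979, 4.2] -/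
theorem IsAutomorphicForm.mem_automorphicForms {φ : 𝒢.Adelic → ℂ} (hφ : IsAutomorphicForm 𝒟 φ) :
    φ ∈ automorphicForms 𝒟 :=
  Submodule.subset_span hφ

/-- Automorphic forms are smooth in the archimedean variable. Borel–Jacquet 1979, 4.2(b). [cite: BorelJacquet1979, 4.2(b] -/
theorem automorphicForms_le_archSmooth : automorphicForms 𝒟 ≤ archSmooth 𝒟.ofArch :=
  Submodule.span_le.mpr fun _ hφ ↦ hφ.archSmooth

/-- Automorphic forms form a complex vector space: sums and scalar multiples of automorphic
forms are automorphic forms, so membership in the span `automorphicForms 𝒟` is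
`IsAutomorphicForm 𝒟` — provided any two levels contain a common level (true for regular
data: `AutomorphyDatum.IsRegular.directedOn_finiteLevels`) and `A` is finite-dimensional
(so that Lie derivatives of smooth functions are smooth, `isArchSmooth_lieDeriv`, which the
additivity of `IsZFinite` uses). Borel–Jacquet 1979, 4.3 (first assertion) with §1.2, §1.6. [cite: BorelJacquet1979, 4.3 (first assertion] -/
def mem_automorphicForms_iff : Prop :=
  ∀ [FiniteDimensional ℝ A] (hdir : DirectedOn (· ≥ ·) 𝒟.finiteLevels) (φ : 𝒢.Adelic → ℂ),
    φ ∈ automorphicForms 𝒟 ↔ IsAutomorphicForm 𝒟 φ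

/-- A complex subspace `W` of functions on `G(𝔸_K)` is *stable* (a `(𝔤, K_∞) × G(𝔸_f)`-
submodule of the space of automorphic forms): `W` consists of automorphic forms and is stable
under right translation by `G(𝔸_f)`, right translation by `K_∞`, and the Lie derivatives
`X φ`, `X ∈ 𝔤`. Borel–Jacquet 1979, 4.3 and 4.6. [cite: BorelJacquet1979, 4.3 and 4.6] -/
structure IsStableSubmodule (W : Submodule ℂ (𝒢.Adelic → ℂ)) : Prop where
  /-- `W` consists of automorphic forms. -/
  le_automorphicForms : W ≤ automorphicForms 𝒟
  /-- `W` is stable under right translation by `G(𝔸_f)`. -/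
  finite_stable : ∀ h ∈ 𝒟.finiteAdelic, W ≤ W.comap (rightTranslation 𝒢 h)
  /-- `W` is stable under right translation by `K_∞`. -/
  k_stable : ∀ k : 𝒟.arch.maximalCompact, W ≤ W.comap (rightTranslation 𝒢 (𝒟.ofK k))
  /-- `W` is stable under the Lie derivatives `X φ`, `X ∈ 𝔤`. -/
  lie_stable : ∀ X : 𝒟.arch.lie, ∀ φ ∈ W, lieDeriv 𝒟.ofArch X φ ∈ W

/-- **Borel–Jacquet 1979, 4.3 (second assertion).** The space of automorphic forms is stable
under right translation by `G(𝔸_f)` and `K_∞` and under `𝔤` (so it is a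
`(𝔤, K_∞) × G(𝔸_f)`-module), for a regular datum over a finite-dimensional coefficient algebra
`A` whose involution is `ℝ`-linear (`[StarModule ℝ A]`).

On the hypothesis `[StarModule ℝ A]` (restated 2026-08-15, name kept; previously the body read
`∀ [FiniteDimensional ℝ A] (h𝒟 : 𝒟.IsRegular), IsStableSubmodule 𝒟 (automorphicForms 𝒟)` under
the bare section binder `[StarRing A]`, i.e. for an ARBITRARY involution of `A`). In the source
(§4.1) the archimedean group is `G_∞ = G(K ⊗_ℚ ℝ)`, a real Lie group with maximal compact subgroup
`K_∞`, so the coefficient algebra is `A = K ⊗_ℚ ℝ ≅ ℝ^{r₁} × ℂ^{r₂}` with its standard, `ℝ`-linear,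
involution; every published proof of 4.3 (Harish-Chandra's `φ = φ ∗ α`, HC 1966, §8, Lemma 13 /
LNM 62, Thm. 1; Borel 1997, 2.14 and 5.6) and the formal one (`AutomorphicFormsStableHolds`) use
that `K_∞ = G_∞ ∩ U(N, A)` is compact and `𝔨 = 𝔤 ∩ 𝔲(N, A)` a real subspace, which is exactly
`[StarModule ℝ A]` (`RealMatrixGroup.isCompact_maximalCompact`). `AutomorphyDatum.IsRegular` does
not imply it: `exists_starRing_isStarFormallyReal_not_starModule` (`RealMatrixGroupsWildStar`)
is a star-formally-real involution of `ℂ` (complex conjugation twisted by a wild automorphism)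
that is not `ℝ`-linear, for which `U(1, A)` is unbounded — a coefficient involution outside the
source's setting, where no argument applies. The old body was therefore wider than the printed
theorem (verdict `misstated`); the instance binder is placed LAST so that every producer
`intro _ h𝒟; exact …` and every consumer `h h𝒟` in the tree elaborates unchanged, and for
`A = mixedSpace K` (the `GL_n` datum) the statement is unchanged up to the inhabited instance.
Proved for every datum in `AutomorphicFormsStableHolds`
(`isStableSubmodule_automorphicForms_of_isRegular`,
`automorphicForms_isStableSubmodule_holds_of_starModule`); the closed all-data form is
`automorphicForms_isStableSubmodule_starModule` (`AutomorphicFormsStableStarModule`, discharged).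
Borel–Jacquet 1979, §4.1 (setting) and 4.3 (using §1.2, §1.5–1.6 and Harish-Chandra's convolution
lemma `φ = φ ∗ α`); restated in Grobner 2023 (`Grobner2023SmoothAutomorphic`), §11.4: Def. 11.21,
Lemma 11.22 ("cf. [Bor-Jac79], Def. 4.2") and the remark after Def. 11.21 that each `𝒜_𝒥(G)` is a
`(𝔤_∞, K_∞, G(𝔸_f))`-module (Lem. 10.43), with `K_∞` "a fixed maximal compact subgroup of the
real Lie group `G_∞ = G(F ⊗_ℚ ℝ)`" (§1). [cite: BorelJacquetCorvallis1979, 4.3] -/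
def automorphicForms_isStableSubmodule : Prop :=
  ∀ [FiniteDimensional ℝ A] (h𝒟 : 𝒟.IsRegular) [StarModule ℝ A],
    IsStableSubmodule 𝒟 (automorphicForms 𝒟)

/-! ## Harish-Chandra's finiteness hypothesis (BJ 4.3(i)) -/

/-- The space `𝒜(U, J)` spanned by the automorphic forms that are right invariant under the
level `U` and annihilated by the ideal `J ≤ Z(𝔤)` (acting through central words).
Borel–Jacquet 1979, 4.3(i) (the space `𝒜(G(K)\G(𝔸), σ, J, K)` before fixing the `K_∞`-type). [cite: BorelJacquet1979, 4.3(i] -/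
def levelForms (U : Subgroup 𝒢.Adelic) (J : Ideal (centerU 𝒟.arch)) :
    Submodule ℂ (𝒢.Adelic → ℂ) :=
  Submodule.span ℂ {φ | IsAutomorphicForm 𝒟 φ ∧ IsRightInvariantUnder U φ ∧
    ∀ (p : FreeAlgebra ℝ 𝒟.arch.lie) (hp : IsCentralWord p),
      (⟨freeToEnveloping 𝒟.arch p, hp⟩ : centerU 𝒟.arch) ∈ J → applyFree 𝒟.ofArch p φ = 0}

/-- The space `Hom_{K_∞}(τ, S)` of `K_∞`-equivariant complex linear maps from a representation
`τ` of `K_∞` to functions on `G(𝔸_K)` (with `K_∞` acting by right translation) with values in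
the subspace `S`. Its dimension is the multiplicity of `τ` in `S` (no `K_∞`-stability of `S` is
presupposed). Borel–Jacquet 1979, 4.3(i) (forms of a fixed `K_∞`-type). [cite: BorelJacquet1979, 4.3(i] -/
def kHomInto {W : Type*} [AddCommGroup W] [Module ℂ W]
    (τ : Representation ℂ 𝒟.arch.maximalCompact W) (S : Submodule ℂ (𝒢.Adelic → ℂ)) :
    Submodule ℂ (W →ₗ[ℂ] (𝒢.Adelic → ℂ)) where
  carrier := {f | (∀ k v, f (τ k v) = rightTranslation 𝒢 (𝒟.ofK k) (f v)) ∧ ∀ v, f v ∈ S}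
  zero_mem' := ⟨fun k v ↦ by simp, fun v ↦ by simp⟩
  add_mem' {f g} hf hg :=
    ⟨fun k v ↦ by simp [hf.1 k v, hg.1 k v], fun v ↦ S.add_mem (hf.2 v) (hg.2 v)⟩
  smul_mem' c f hf :=
    ⟨fun k v ↦ by simp [hf.1 k v], fun v ↦ S.smul_mem c (hf.2 v)⟩

/-- `f ∈ kHomInto 𝒟 τ S` iff `f` intertwines `τ` with right `K_∞`-translation and takes values
in `S`. Borel–Jacquet 1979, 4.3(i). [cite: BorelJacquet1979, 4.3(i] -/
theorem mem_kHomInto_iff {W : Type*} [AddCommGroup W] [Module ℂ W]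
    (τ : Representation ℂ 𝒟.arch.maximalCompact W) (S : Submodule ℂ (𝒢.Adelic → ℂ))
    (f : W →ₗ[ℂ] (𝒢.Adelic → ℂ)) :
    f ∈ kHomInto 𝒟 τ S ↔
      (∀ k v, f (τ k v) = rightTranslation 𝒢 (𝒟.ofK k) (f v)) ∧ ∀ v, f v ∈ S :=
  Iff.rfl

/-- **Harish-Chandra's finiteness hypothesis** on an automorphy datum (a hypothesis structure,
not part of the datum, exactly like `IsRegular`): for every level `U`, every ideal `J ≤ Z(𝔤)`
of finite codimension and every finite-dimensional representation `τ` of `K_∞`, the `τ`-isotypic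
part of `𝒜(U, J)` is finite-dimensional, i.e. `dim Hom_{K_∞}(τ, 𝒜(U, J)) < ∞`. This is
Borel–Jacquet 1979, 4.3(i) (Harish-Chandra, LNM 62, Thm. 1), which rests on reduction theory
for the reductive group `G` over `K`; nothing in `AutomorphyDatum`/`IsRegular` implies it (it
fails e.g. for `G_∞ = 1` and `G(𝔸_f)` an arbitrary discrete group), so it is recorded as an
explicit hypothesis, discharged for `GL_n` in `AdelicGLnGlue`. (H9: `W : Type`.) [cite: BorelJacquet1979, 4.3(i] -/
structure AutomorphyDatum.HasFiniteness : Prop where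
  /-- `dim Hom_{K_∞}(τ, 𝒜(U, J)) < ∞` for `U` a level, `J ≤ Z(𝔤)` of finite codimension and
  `τ` a finite-dimensional representation of `K_∞`. -/
  finiteDimensional_kHomInto : ∀ U ∈ 𝒟.finiteLevels, ∀ J : Ideal (centerU 𝒟.arch),
    FiniteDimensional ℝ (centerU 𝒟.arch ⧸ J) →
    ∀ (W : Type) [AddCommGroup W] [Module ℂ W] [FiniteDimensional ℂ W]
      (τ : Representation ℂ 𝒟.arch.maximalCompact W),
      FiniteDimensional ℂ (kHomInto 𝒟 τ (levelForms 𝒟 U J))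

end Forms

/-! ## Automorphic representations (BJ 4.6) -/

/-- An **automorphic representation** of `G(𝔸_K)` with respect to `𝒟`, as a datum: two
`(𝔤, K_∞) × G(𝔸_f)`-stable subspaces `W' < W` of the space of automorphic forms such that
`W / W'` is irreducible, i.e. there is no stable subspace strictly between `W'` and `W`.
Borel–Jacquet 1979, 4.6 ("an irreducible representation of `(𝔤, K_∞) × G(𝔸_f)` isomorphic to
a subquotient of `𝒜`"). [cite: BorelJacquet1979, 4.6 ("an irreducible representation of] -/
structure AutomorphicRepData {𝒢 : AdelicGroupData K} (𝒟 : AutomorphyDatum 𝒢 A N) where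
  /-- The larger stable subspace `W ≤ 𝒜`. -/
  W : Submodule ℂ (𝒢.Adelic → ℂ)
  /-- The smaller stable subspace `W' < W`. -/
  W' : Submodule ℂ (𝒢.Adelic → ℂ)
  /-- `W' < W`, so that `W / W' ≠ 0`. -/
  lt : W' < W
  /-- `W` is stable. -/
  stable : IsStableSubmodule 𝒟 W
  /-- `W'` is stable. -/
  stable' : IsStableSubmodule 𝒟 W'
  /-- `W / W'` is irreducible: no stable subspace strictly between `W'` and `W`. -/
  irreducible : ∀ W'' : Submodule ℂ (𝒢.Adelic → ℂ), W' ≤ W'' → W'' ≤ W →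
    IsStableSubmodule 𝒟 W'' → W'' = W' ∨ W'' = W

namespace AutomorphicRepData

variable {𝒢 : AdelicGroupData K} {𝒟 : AutomorphyDatum 𝒢 A N} (π : AutomorphicRepData 𝒟)

/-- `W'` viewed inside `W`, the kernel of `W → W / W'`. Borel–Jacquet 1979, 4.6. [cite: BorelJacquet1979, 4.6] -/
def kerQuot : Submodule ℂ π.W := π.W'.comap π.W.subtype

/-- The representation space `W / W'` of the automorphic representation `π` (outline name;
it shadows core `Quot` inside `namespace AutomorphicRepData` only). Borel–Jacquet 1979, 4.6. [cite: BorelJacquet1979, 4.6] -/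
abbrev Quot : Type _ := π.W ⧸ π.kerQuot

/-- The quotient map `W →ₗ[ℂ] W / W'` (`Submodule.mkQ`). Borel–Jacquet 1979, 4.6. [cite: BorelJacquet1979, 4.6] -/
abbrev mkQ : π.W →ₗ[ℂ] π.Quot := π.kerQuot.mkQ

/-- Right translation by `G(𝔸_f)` on `W`. Borel–Jacquet 1979, 4.6. [cite: BorelJacquet1979, 4.6] -/
def finiteRepW : Representation ℂ 𝒟.finiteAdelic π.W :=
  Representation.subrepresentation
    (MonoidHom.comp (rightTranslation 𝒢) 𝒟.finiteAdelic.subtype :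
      Representation ℂ 𝒟.finiteAdelic (𝒢.Adelic → ℂ))
    π.W fun h ↦ π.stable.finite_stable h h.2

/-- Right translation by `K_∞` on `W`. Borel–Jacquet 1979, 4.6. [cite: BorelJacquet1979, 4.6] -/
def kRepW : Representation ℂ 𝒟.arch.maximalCompact π.W :=
  Representation.subrepresentation
    (MonoidHom.comp (rightTranslation 𝒢) 𝒟.ofK :
      Representation ℂ 𝒟.arch.maximalCompact (𝒢.Adelic → ℂ))
    π.W fun k ↦ π.stable.k_stable k

/-- The representation of `G(𝔸_f)` on `W / W'` by right translation
(`Representation.quotient`; the side condition is the stability of `W'`). As a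
`(𝔤, K_∞) × G(𝔸_f)`-module `W / W' ≅ π_∞ ⊗ π_f`; this is the `G(𝔸_f)`-action on the whole of
it, not the tensor factor `π_f`. Borel–Jacquet 1979, 4.6. [cite: BorelJacquet1979, 4.6] -/
def finiteRep : Representation ℂ 𝒟.finiteAdelic π.Quot :=
  π.finiteRepW.quotient π.kerQuot fun h φ hφ ↦ by
    simp only [kerQuot, Submodule.mem_comap, Submodule.subtype_apply] at hφ ⊢
    exact π.stable'.finite_stable h h.2 hφ

/-- The representation of `K_∞` on `W / W'` by right translation (`Representation.quotient`).
Borel–Jacquet 1979, 4.6. [cite: BorelJacquet1979, 4.6] -/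
def kRep : Representation ℂ 𝒟.arch.maximalCompact π.Quot :=
  π.kRepW.quotient π.kerQuot fun k φ hφ ↦ by
    simp only [kerQuot, Submodule.mem_comap, Submodule.subtype_apply] at hφ ⊢
    exact π.stable'.k_stable k hφ

/-- `π.finiteRep h [φ] = [r(h) φ]`. Borel–Jacquet 1979, 4.6. [cite: BorelJacquet1979, 4.6] -/
@[simp]
theorem finiteRep_mk (h : 𝒟.finiteAdelic) (φ : π.W) :
    π.finiteRep h (Submodule.Quotient.mk φ) =
      Submodule.Quotient.mk (p := π.kerQuot)
        ⟨rightTranslation 𝒢 (h : 𝒢.Adelic) φ, π.stable.finite_stable h h.2 φ.2⟩ := rfl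

/-- `π.kRep k [φ] = [r(k) φ]`. Borel–Jacquet 1979, 4.6. [cite: BorelJacquet1979, 4.6] -/
@[simp]
theorem kRep_mk (k : 𝒟.arch.maximalCompact) (φ : π.W) :
    π.kRep k (Submodule.Quotient.mk φ) =
      Submodule.Quotient.mk (p := π.kerQuot)
        ⟨rightTranslation 𝒢 (𝒟.ofK k) φ, π.stable.k_stable k φ.2⟩ :=
  rfl

/-- The actions of `K_∞` and `G(𝔸_f)` on `W / W'` commute (since `G_∞` and `G(𝔸_f)` commute
in `G(𝔸_K)`). Borel–Jacquet 1979, 4.6. [cite: BorelJacquet1979, 4.6] -/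
theorem kRep_comm_finiteRep (k : 𝒟.arch.maximalCompact) (h : 𝒟.finiteAdelic) (v : π.Quot) :
    π.kRep k (π.finiteRep h v) = π.finiteRep h (π.kRep k v) := by
  induction v using Submodule.Quotient.induction_on with
  | H φ =>
    simp only [finiteRep_mk, kRep_mk]
    congr 2
    ext g
    simp only [rightTranslation_apply, mul_assoc, AutomorphyDatum.ofK_apply]
    rw [𝒟.commute_ofArch _ _ h.2]

/-- The `K_∞`-representation on the `U`-fixed vectors `(W / W')^U` of `π.finiteRep`, for a
subgroup `U ≤ G(𝔸_f)` (well defined by `kRep_comm_finiteRep`). For `W / W' ≅ π_∞ ⊗ π_f` this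
is `π_∞ ⊗ π_f^U`. Borel–Jacquet 1979, 4.5–4.6. [cite: BorelJacquet1979, 4.5–4.6] -/
def kRepFixed (U : Subgroup 𝒟.finiteAdelic) :
    Representation ℂ 𝒟.arch.maximalCompact (π.finiteRep.fixedPoints U) :=
  Representation.subrepresentation π.kRep _ fun k v hv ↦ by
    simp only [Submodule.mem_comap, Representation.mem_fixedPoints] at hv ⊢
    intro h hh
    rw [← π.kRep_comm_finiteRep, hv h hh]

/-- The Lie derivative `X φ ∈ W` of `φ ∈ W`, as an element of `W`. Borel–Jacquet 1979, 4.6. [cite: BorelJacquet1979, 4.6] -/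
def lieDerivW (X : 𝒟.arch.lie) (φ : π.W) : π.W :=
  ⟨lieDeriv 𝒟.ofArch X φ, π.stable.lie_stable X φ φ.2⟩

/-- `ρ𝔤 : 𝔤 →ₗ⁅ℝ⁆ End_ℂ (W / W')` *is the Lie algebra action of `π`*: `ρ𝔤 X [φ] = [X φ]` for
`φ ∈ W`, where `X φ` is the Lie derivative through right translation. (The action exists and is
unique: `exists_hasLieAction`, `hasLieAction_unique`.) Borel–Jacquet 1979, 4.6 with §1.5. [cite: BorelJacquet1979, 4.6 with §1.5] -/
def HasLieAction (ρ𝔤 : 𝒟.arch.lie →ₗ⁅ℝ⁆ Module.End ℂ π.Quot) : Prop :=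
  ∀ (X : 𝒟.arch.lie) (φ : π.W), ρ𝔤 X (π.mkQ φ) = π.mkQ (π.lieDerivW X φ)

/-- `π` has *infinitesimal character* `θ : Z(𝔤) →ₐ[ℝ] ℂ`: `Z(𝔤)` acts on `W / W'` through the
Lie algebra action of `π` by the scalars `θ`. (Stated with `∃ ρ𝔤`; the action exists and is
unique for finite-dimensional `A`, `exists_hasLieAction`, `hasLieAction_unique`.)
Borel–Jacquet 1979, 4.4–4.6; Knapp–Vogan (4.113). [cite: BorelJacquet1979, 4.4–4.6] -/
def HasInfinitesimalCharacter (θ : centerU 𝒟.arch →ₐ[ℝ] ℂ) : Prop :=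
  ∃ ρ𝔤 : 𝒟.arch.lie →ₗ⁅ℝ⁆ Module.End ℂ π.Quot,
    π.HasLieAction ρ𝔤 ∧ Automorphic.HasInfinitesimalCharacter ρ𝔤 θ

/-- `π` is *cuspidal in* `C` (a space of cusp forms, supplied by the instance, e.g.
`CuspConditionGL`): every form of `W` lies in `C`, so that `π` is realised on cusp forms.
Borel–Jacquet 1979, 4.6 (cuspidal automorphic representations). [cite: BorelJacquet1979, 4.6 (cuspidal automorphic representation] -/
def IsCuspidalIn (C : Submodule ℂ (𝒢.Adelic → ℂ)) : Prop :=
  π.W ≤ C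

/-- The Lie algebra action on `W / W'` exists: `X ↦ (φ ↦ X φ)` is real-linear in `X`, complex
linear in `φ` on smooth functions, a Lie algebra homomorphism (`[X, Y] φ = X (Y φ) - Y (X φ)`),
and preserves `W'`. Borel–Jacquet 1979, §1.5 and 4.6. [cite: BorelJacquet1979, §1.5 and 4.6] -/
def exists_hasLieAction : Prop :=
  ∀ [FiniteDimensional ℝ A],
    ∃ ρ𝔤 : 𝒟.arch.lie →ₗ⁅ℝ⁆ Module.End ℂ π.Quot, π.HasLieAction ρ𝔤

/-- The Lie algebra action on `W / W'` is unique (`W → W / W'` is surjective).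
Borel–Jacquet 1979, 4.6. [cite: BorelJacquet1979, 4.6] -/
theorem hasLieAction_unique {ρ𝔤 ρ𝔤' : 𝒟.arch.lie →ₗ⁅ℝ⁆ Module.End ℂ π.Quot}
    (h : π.HasLieAction ρ𝔤) (h' : π.HasLieAction ρ𝔤') : ρ𝔤 = ρ𝔤' := by
  ext X : 1
  refine Submodule.linearMap_qext _ (LinearMap.ext fun φ ↦ ?_)
  simp only [LinearMap.coe_comp, Function.comp_apply]
  exact (h X φ).trans (h' X φ).symm

/-- `W / W'` with its `K_∞`-action and Lie algebra action is a `(𝔤, K_∞)`-module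
(`K_∞`-finite, weakly continuous, `Ad`-compatible, with the right differential along `𝔨`), for
a regular datum (`𝔤` the full Lie algebra of `G_∞`, so that smoothness in the archimedean
variable gives continuity of `k ↦ r(k) φ`; false without it).
Borel–Jacquet 1979, 4.6 with §1.3–1.5; Wallach, *Real Reductive Groups I*, §3.3.1. [cite: BorelJacquet1979, 4.6 with §1.3–1.5] -/
def isGKModule_of_hasLieAction : Prop :=
  ∀ [StarModule ℝ A] [ContinuousStar A] [FiniteDimensional ℝ A] (h𝒟 : 𝒟.IsRegular) {ρ𝔤 : 𝒟.arch.lie →ₗ⁅ℝ⁆ Module.End ℂ π.Quot} (h : π.HasLieAction ρ𝔤),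
    IsGKModule 𝒟.arch π.kRep ρ𝔤

/-- The `G(𝔸_f)`-action on `W / W'` is smooth: every vector is fixed by an open subgroup of
`G(𝔸_f)` (each automorphic form is right invariant under a level, levels are open and
directed for a regular datum). Borel–Jacquet 1979, 4.2(a), 4.3 and 4.6. [cite: BorelJacquet1979, 4.2(a] -/
def isSmooth_finiteRep : Prop :=
  ∀ (h𝒟 : 𝒟.IsRegular),
    π.finiteRep.IsSmooth

/-- The automorphic representation datum `π` *is admissible* (as a
`(𝔤, K_∞) × G(𝔸_f)`-module, BJ 4.5–4.6): the `G(𝔸_f)`-action on `W / W'` is smooth and, for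
every compact open `U ≤ G(𝔸_f)`, the `K_∞`-module `(W / W')^U` has finite
`K_∞`-multiplicities. (For
`W / W' ≅ π_∞ ⊗ π_f` this says `π_∞` and `π_f` are admissible; note that `π.finiteRep` itself
is *not* `Representation.IsAdmissible` unless `π_∞` is finite-dimensional.)

This is a DEFINITION — a predicate on the datum `π`, written with `π` as an explicit binder of
the declaration (formerly supplied by the section `variable (π)`, which made the declaration read
textually as a closed `def IsAdmissible : Prop`; the constant is unchanged) — and not a named fact
awaiting discharge: there is no `IsAdmissible_holds`, its universal closure `∀ π, π.IsAdmissible`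
being false for a general automorphy datum — refuted in the tree by
`AutomorphicRepData.not_forall_isAdmissible`
(`Literature.NumberTheory.Automorphic.AutomorphicRepAdmissibility`: over the junk datum
`G(𝔸_f) = 𝕊¹` the line spanned by the character `χ(z) = z` is an irreducible stable subquotient
of the automorphic forms whose `G(𝔸_f)`-action is not smooth). The *theorem* of Borel–Jacquet
4.5–4.6 (automorphic representations of a connected reductive group are admissible, through
Harish-Chandra's finiteness theorem 4.3 (i)) is the named fact `isAdmissible_finiteRep` below
(regular datum, hypothesis `HasFiniteness`), which packages `isSmooth_finiteRep` and
`isAdmissibleGK_kRepFixed`. Definition: Borel–Jacquet 1979, 4.5 (admissible representations of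
`G(𝔸)` as `(𝔤, K_∞) × G(𝔸_f)`-modules) and 4.6. [cite: BorelJacquetCorvallis1979, 4.5 and 4.6] -/
def IsAdmissible (π : AutomorphicRepData 𝒟) : Prop :=
  π.finiteRep.IsSmooth ∧ ∀ U : OpenSubgroup 𝒟.finiteAdelic,
    IsCompact (U : Set 𝒟.finiteAdelic) → IsAdmissibleGK (π.kRepFixed U)

/-- **Admissibility of automorphic representations** (BJ 4.5 shape), under Harish-Chandra's
finiteness hypothesis `𝒟.HasFiniteness` (BJ 4.3(i)): for every compact open `U ≤ G(𝔸_f)` the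
`K_∞`-module `(W / W')^U` has finite `K_∞`-multiplicities. Proof in print: a `U`-fixed vector
of `W / W'` lifts to `φ ∈ W^U` (smoothness + averaging over the compact `U`); `φ` is killed by
an ideal `J ≤ Z(𝔤)` of finite codimension, which may be taken `Ad(K_∞)`-stable (`K_∞` has
finitely many components); `{ψ ∈ W | J ψ = 0} + W'` is stable and `≠ W'`, hence `= W` by
irreducibility, so `(W / W')^U` is a `K_∞`-quotient of `{ψ ∈ W^{U'} | J ψ = 0} ≤ 𝒜(U', J)` for a
level `U' ≤ U`, whose `τ`-multiplicities are finite by `HasFiniteness` (the quotient step uses the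
complete reducibility of `K_∞`-modules of automorphic forms, i.e. the compactness of `K_∞`).
Without that hypothesis the statement is false for a general datum. Hypotheses: a regular datum
over a finite-dimensional coefficient algebra whose involution is `ℝ`-linear (`[StarModule ℝ A]`:
this is what makes `K_∞ = G_∞ ∩ U(N, A)` compact, `RealMatrixGroup.isCompact_maximalCompact`,
and holds for `A ≅ ℝ^r × ℂ^s`; for a non-`ℝ`-linear involution, e.g. a discontinuous involutive
field automorphism of `ℂ`, `U(1, A)` is unbounded; the instance binder follows the hypotheses so
that the reduction `isAdmissible_finiteRep_of_isAdmissibleGK_kRepFixed` of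
`AutomorphicRepAdmissibility` elaborates unchanged). Proved in `AutomorphicRepAdmissibilityProofs`.
Borel–Jacquet 1979, 4.3(i), 4.5 and 4.6; Harish-Chandra, LNM 62, Thm. 1. [cite: BorelJacquet1979, 4.3(i] -/
def isAdmissibleGK_kRepFixed : Prop :=
  ∀ [FiniteDimensional ℝ A] (h𝒟 : 𝒟.IsRegular) (hfin : 𝒟.HasFiniteness) [StarModule ℝ A]
    (U : OpenSubgroup 𝒟.finiteAdelic) (hU : IsCompact (U : Set 𝒟.finiteAdelic)),
    IsAdmissibleGK (π.kRepFixed U)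

/-- Automorphic representations are admissible, for a regular datum over a finite-dimensional
coefficient algebra with `ℝ`-linear involution (`[StarModule ℝ A]`, compactness of `K_∞`; the
binder follows the hypotheses, as in `isAdmissibleGK_kRepFixed`) satisfying Harish-Chandra's
finiteness hypothesis (packages `isSmooth_finiteRep` and `isAdmissibleGK_kRepFixed`). Proved in
`AutomorphicRepAdmissibilityProofs`. Borel–Jacquet 1979, 4.5 and 4.6. [cite: BorelJacquet1979, 4.5 and 4.6] -/
def isAdmissible_finiteRep : Prop :=
  ∀ [FiniteDimensional ℝ A] (h𝒟 : 𝒟.IsRegular) (hfin : 𝒟.HasFiniteness) [StarModule ℝ A],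
    π.IsAdmissible

/- interim proof relied on results that are now named facts (D-0014); demoted to a fact by the M5 import, proof preserved:
:=
  ⟨π.isSmooth_finiteRep h𝒟, π.isAdmissibleGK_kRepFixed h𝒟 hfin⟩
-/

end AutomorphicRepData

end Literature.NumberTheory.Automorphic
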